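import Summits.CriticalPhenomena.PercolationContinuityZ3.Theorems.PercNearOneGluingNoHeavyConstsLinearLowerTailFourFreeCore
import Summits.CriticalPhenomena.PercolationContinuityZ3.Theorems.PercNearOneGluingNoHeavyConstsLinearLowerTailThreeHalvesPartial
import HarnessLib

/-!
# (LT³⁄₂) for four relay points and an outside observer — every instance with `|A| ≤ 4`

builds on p205010 (kernel theorem, internal audit signed; external expert review pending)

PAPER-2 track "percolation constants", part (ii), seat `prim-consts-1` (lane index `run/shared/lean/prim/consts/CONSTANTS.md`,
row A19, §4 N18/N23).  Support file for the crux `NoHeavyLowerTail` (stmt-CriticalPhenomena-4575; `--supports`): theorems only.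

The conjecture `Consts.LinearLowerTailThreeHalves` (`…ConstsLinearLowerTailConjecture`): for `0 < κ ≤ 2/3`, every finite weighted
graph, relay set `A`, observer `o` and `s ≥ max P(a ↮ a')`, `P(1 ≤ N < κ·EN) ≤ (3/2)·s`.  Proved before this file: `κ ≤ 1/3`;
`|A| ≤ 3` (any observer); `o ∈ A` with `κ|A| ≤ 4` or `|A| ≤ 6` (`…ThreeHalvesPartial`, `…Five`, `…Six`); the clustered class.  The
smallest case left open was `|A| = 4` with the observer OUTSIDE `A` (`CONSTANTS.md` §4 N18): there the bad event is "`o` is joined to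
exactly one or two of the four relay points", whose best POINTWISE pair-charging bound is `2·s`.  This file closes it:

* `Consts.real_card_obs_mem_le_three_halves` — observer `o`, four distinct relay points, all six relay pairs `μ(x k ↮ x l) ≤ s`
  (nothing assumed about the pairs `(o, x k)`): `μ(#{k : o ↔ x k} ∈ {1, 2}) ≤ (3/2)·s` (not claimed sharp for this event, see below).  Proof: fibre
  decomposition over the 52 connectivity patterns (`…FourFreeDatum`) and the certificate `Consts.FourFree.core` (`…FourFreeCore`),
  whose only input beyond the pair budgets is vdBHK Thm. 1.3 at the relay points (`Consts.FourFree.pa_one`).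
* `Consts.real_lowerTail_le_three_halves_of_card_le_four` — (LT³⁄₂) for EVERY instance with `|A| ≤ 4` (any observer — inside
  or outside `A` —, all weights, all `s`, every `0 < κ ≤ 2/3`): for `|A| = 4` the bad event forces `N ∈ {1, 2}` and the previous
  theorem applies with the four points of `A` (the observer may be one of them); `|A| ≤ 3` is `…ThreeHalvesPartial`.
* `Consts.linearLowerTailThreeHalves_of_card_le_four` — the same in the conjecture's quantifier shape.

References: J. van den Berg, O. Häggström, J. Kahn, Random Structures Algorithms 29 (2006) 417–435, Thm. 1.3 (p. 6);
G. Kozma, N. Nitzan, arXiv:2401.12397 (2024), Conjecture 1 (p. 3).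
-/

noncomputable section

namespace Summit.CriticalPhenomena.PercolationContinuityZ3.Theorems

open MeasureTheory Set Literature.Probability.LatticeModels Literature.Probability.Percolation
open scoped Classical

namespace Consts

open FourFree in
/-- **Anti-halving for four relay points seen from OUTSIDE.**  Observer `o` and four distinct relay points `x 0, …, x 3` with all
six pairwise unreliabilities `μ(x k ↮ x l) ≤ s` (nothing is assumed about the pairs `(o, x k)`): the probability that `o` is joined
to EXACTLY ONE OR TWO of the four is `≤ (3/2)·s`.  Pointwise pair charging gives only `2·s`; the input beyond pair marginals is
vdBHK Thm. 1.3 at the relay points (`FourFree.pa_one`) through the certificate `FourFree.core`.  The constant `3/2` is what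
(LT³⁄₂) needs; it is NOT claimed to be attained by this four-point event (hub gadgets give ratio `1`; degree-2 association
certificates reach `≈ 1.43`, kit j124812 — correction of the first landed docstring, which said "sharp").
[cite: VandenbergHaggstromKahn2005, Thm. 1.3 (p. 6)] -/
theorem real_card_obs_mem_le_three_halves (n : ℕ) (w : Sym2 (Fin n) → unitInterval) (o : Fin n) (x : Fin 4 → Fin n)
    (hx : Function.Injective x) {s : ℝ} (hss : ∀ k l, k ≠ l → (prodBernoulli w).real (openConn (x k) (x l))ᶜ ≤ s) :
    (prodBernoulli w).real {ω | (Finset.univ.filter fun k => ω ∈ openConn o (x k)).card ∈ ({1, 2} : Finset ℕ)} ≤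
      3 / 2 * s := by
  set μ := prodBernoulli w with hμ
  set e : D4 → ℝ := fun d => μ.real {ω | datum o x ω = d} with he_def
  have he : ∀ d, 0 ≤ e d := fun d => measureReal_nonneg
  -- the target event through the datum
  have hbad : {ω : BondConfig (Fin n) | (Finset.univ.filter fun k => ω ∈ openConn o (x k)).card ∈ ({1, 2} : Finset ℕ)} =
      {ω | ((if (datum o x ω).get 0 = 0 then 1 else 0) + (if (datum o x ω).get 1 = 0 then 1 else 0) +
        (if (datum o x ω).get 2 = 0 then 1 else 0) + (if (datum o x ω).get 3 = 0 then 1 else 0) : ℕ) ∈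
          ({1, 2} : Finset ℕ)} := by
    ext ω
    simp only [mem_setOf_eq, Finset.card_filter, Fin.sum_univ_four, obs_iff o x ω]
  rw [hbad, real_setOf_datum w o x (fun d => ((if d.get 0 = 0 then 1 else 0) + (if d.get 1 = 0 then 1 else 0) +
    (if d.get 2 = 0 then 1 else 0) + (if d.get 3 = 0 then 1 else 0) : ℕ) ∈ ({1, 2} : Finset ℕ))]
  -- the three kinds of events read off the datum
  have hS : ∀ i j : Fin 4, {ω : BondConfig (Fin n) | (datum o x ω).get i ≠ (datum o x ω).get j} =
      (openConn (x i) (x j))ᶜ := fun i j => by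
    ext ω; simp only [mem_setOf_eq, mem_compl_iff, conn_iff o x ω]
  have hO : ∀ i : Fin 4, {ω : BondConfig (Fin n) | (datum o x ω).get i = 0} = openConn (x i) o := fun i => by
    rw [KNPreFKG.openConn_symm]; ext ω; simp only [mem_setOf_eq, obs_iff o x ω]
  have hX : ∀ i a : Fin 4, {ω : BondConfig (Fin n) | (datum o x ω).get i = (datum o x ω).get a} = openConn (x i) (x a) :=
    fun i a => by ext ω; simp only [mem_setOf_eq, conn_iff o x ω]
  have hne : ∀ {i j : Fin 4}, i ≠ j → x i ≠ x j := fun hij h => hij (hx h)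
  refine core e s he ?_ ?_
  · -- the six relay-pair budgets
    intro k l hkl
    rw [← real_setOf_datum w o x (fun d => d.get k ≠ d.get l), hS]
    exact hss k l hkl
  · -- positive association of `o ∈ C(x i)` and `x a ∈ C(x i)` given `x i ↮ x j`
    intro i j a hij _hai
    rw [← real_setOf_datum w o x (fun d => d.get i ≠ d.get j ∧ d.get i = 0),
      ← real_setOf_datum w o x (fun d => d.get i ≠ d.get j ∧ d.get i = d.get a),
      ← real_setOf_datum w o x (fun d => d.get i ≠ d.get j),
      ← real_setOf_datum w o x (fun d => d.get i ≠ d.get j ∧ (d.get i = 0 ∧ d.get i = d.get a)),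
      setOf_and, setOf_and, setOf_and, setOf_and, hS, hO, hX]
    exact pa_one w (x i) (x j) o (x a) (hne hij)

/-- **(LT³⁄₂) for `|A| ≤ 4`, ANY observer, every `κ ≤ 2/3`** (all finite weighted graphs, all `s`): `P(1 ≤ N < κ·EN) ≤ (3/2)·s`.
For `|A| ≤ 3` this is `Consts.linearLowerTailThreeHalves_of_card_le_three`; for `|A| = 4` the bad event forces `1 ≤ N ≤ 2` (as
`κ·EN ≤ 8/3 < 3`), and `Consts.real_card_obs_mem_le_three_halves` applies to the four points of `A` (the observer may be one of
them or not). [cite: KozmaNitzan2024, Conj. 1 (p. 3)] -/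
theorem real_lowerTail_le_three_halves_of_card_le_four (n : ℕ) (w : Sym2 (Fin n) → unitInterval)
    (A : Finset (Fin n)) (o : Fin n) (hA : A.card ≤ 4) {κ s : ℝ} (hκ0 : 0 < κ) (hκ : κ ≤ 2 / 3) (hs : 0 ≤ s)
    (hrel : ∀ a ∈ A, ∀ a' ∈ A, (prodBernoulli w).real (openConn a a')ᶜ ≤ s) :
    (prodBernoulli w).real {ω : BondConfig (Fin n) | 1 ≤ (A.filter fun a => ω ∈ openConn o a).card ∧
        ((A.filter fun a => ω ∈ openConn o a).card : ℝ) < κ * (∑ a ∈ A, (prodBernoulli w).real (openConn o a))} ≤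
      3 / 2 * s := by
  set μ := prodBernoulli w with hμ
  by_cases h3 : A.card ≤ 3
  · exact linearLowerTailThreeHalves_of_card_le_three κ hκ0 hκ n w A o s hs h3 hrel
  have h4 : A.card = 4 := by omega
  -- enumerate the four relay points
  set ε := A.equivFinOfCardEq h4 with hε
  set x : Fin 4 → Fin n := fun k => ((ε.symm k : A) : Fin n) with hx
  have hxA : ∀ k, x k ∈ A := fun k => (ε.symm k).2
  have hxinj : Function.Injective x := by
    intro k k' hkk'
    have : ε.symm k = ε.symm k' := Subtype.ext hkk'
    exact ε.symm.injective this
  have hAmap : A = Finset.univ.map ⟨x, hxinj⟩ := by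
    ext a
    simp only [Finset.mem_map, Finset.mem_univ, Function.Embedding.coeFn_mk, true_and]
    constructor
    · intro ha
      exact ⟨ε ⟨a, ha⟩, by simp [hx]⟩
    · rintro ⟨k, rfl⟩
      exact hxA k
  have hss : ∀ k l, k ≠ l → μ.real (openConn (x k) (x l))ᶜ ≤ s := fun k l _ => hrel (x k) (hxA k) (x l) (hxA l)
  refine le_trans (measureReal_mono ?_) (real_card_obs_mem_le_three_halves n w o x hxinj hss)
  intro ω hω
  simp only [mem_setOf_eq] at hω ⊢
  obtain ⟨h1, hlt⟩ := hω
  have hEN : (∑ a ∈ A, μ.real (openConn o a)) ≤ 4 := by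
    calc (∑ a ∈ A, μ.real (openConn o a)) ≤ ∑ a ∈ A, (1 : ℝ) := Finset.sum_le_sum fun a _ => measureReal_le_one
      _ = 4 := by simp [h4]
  have hN : (A.filter fun a => ω ∈ openConn o a).card = (Finset.univ.filter fun k : Fin 4 => ω ∈ openConn o (x k)).card := by
    rw [hAmap, Finset.filter_map, Finset.card_map]
    rfl
  have hEN0 : (0 : ℝ) ≤ ∑ a ∈ A, μ.real (openConn o a) := Finset.sum_nonneg fun a _ => measureReal_nonneg
  have hN2 : ((A.filter fun a => ω ∈ openConn o a).card : ℝ) < 3 := by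
    have : κ * (∑ a ∈ A, μ.real (openConn o a)) ≤ 2 / 3 * 4 := by nlinarith
    linarith
  have hN2' : (A.filter fun a => ω ∈ openConn o a).card ≤ 2 := by
    exact_mod_cast Nat.lt_succ_iff.1 (by exact_mod_cast hN2)
  rw [← hN]
  simp only [Finset.mem_insert, Finset.mem_singleton]
  omega

/-- **(LT³⁄₂) for `|A| ≤ 4` in the conjecture's quantifier shape**: `Consts.LinearLowerTailThreeHalves` restricted to `|A| ≤ 4`
holds for every `0 < κ ≤ 2/3` (any observer, all weights, all `s`). [cite: KozmaNitzan2024, Conj. 1 (p. 3)] -/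
theorem linearLowerTailThreeHalves_of_card_le_four :
    ∀ κ : ℝ, 0 < κ → κ ≤ 2 / 3 →
      ∀ (n : ℕ) (w : Sym2 (Fin n) → unitInterval) (A : Finset (Fin n)) (o : Fin n) (s : ℝ), 0 ≤ s →
        A.card ≤ 4 →
        (∀ a ∈ A, ∀ a' ∈ A, (prodBernoulli w).real (openConn a a')ᶜ ≤ s) →
        (prodBernoulli w).real {ω : BondConfig (Fin n) | 1 ≤ (A.filter fun a => ω ∈ openConn o a).card ∧
            ((A.filter fun a => ω ∈ openConn o a).card : ℝ) < κ * (∑ a ∈ A, (prodBernoulli w).real (openConn o a))} ≤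
          3 / 2 * s :=
  fun _ hκ0 hκ n w A o _ hs hA hrel => real_lowerTail_le_three_halves_of_card_le_four n w A o hA hκ0 hκ hs hrel

end Consts

end Summit.CriticalPhenomena.PercolationContinuityZ3.Theorems
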